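import Mathlib
import Summits.AnomalousDissipation.AnomalousDissipation.Theorems.DyadicWallCascadeDyadicRealisationLerayCappingTools
import Summits.AnomalousDissipation.AnomalousDissipation.Theorems.DyadicWallCascadeDyadicRealisationLerayCappingTools2
import Summits.AnomalousDissipation.AnomalousDissipation.Theorems.DyadicWallCascadeDyadicRealisationLerayCappingTools3
import Summits.AnomalousDissipation.AnomalousDissipation.Theorems.DyadicWallCascadeDyadicRealisationLerayCappingTools4
import HarnessLib

/-!
# Leray capping, tools V: zero mass flux on every slice, and the lid corrector

Tools file for `stub_lerayCapping` (crux `DyadicRealisation`, line Sketch): for a half-space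
hierarchy `(V, Q)` the horizontal cell integral of `V₂` does not depend on the height in `(0, 1)`
(divergence theorem on `[0,1]² × [s,t]`, lateral faces cancel by periodicity), hence vanishes by
dyadic invariance and the zero-mass-flux clause (`lerayCapping_massflux_*`); and the smooth
horizontally periodic lid corrector `c = (c₀, c₁, 0)` with
`div c = −(θ'(Y₂) V₂(Y) + θ'(1 − Y₂) V₂(A Y))` on `0 < Y₂ < 1`, supported in the two transition
bands of the cut-off `θ` (`lerayCapping_lid_corrector`, row–column antidivergence of tools III
applied to the slice-mean-free source).  Ends with the registered stub `stub_lerayCappingTools5`.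
-/

open Set Function MeasureTheory Filter Topology intervalIntegral
open scoped BigOperators ContDiff

set_option linter.dupNamespace false

namespace Summit.AnomalousDissipation.AnomalousDissipation.Theorems

/-- **Height independence of the mass flux.** For `V` smooth and divergence free on the upper
half-space, `1`-periodic in `X₀, X₁` on `0 < X₂ ≤ 2`, the cell integral
`∫_{[0,1]²} V₂(q, t) dq` is the same for all heights `0 < s ≤ t < 1`. [folklore] -/
theorem lerayCapping_massflux_indep
    (V : EuclideanSpace ℝ (Fin 3) → EuclideanSpace ℝ (Fin 3))
    (hV : ContDiffOn ℝ ((⊤ : ℕ∞) : WithTop ℕ∞) V {X : EuclideanSpace ℝ (Fin 3) | 0 < X 2})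
    (hdiv : ∀ X : EuclideanSpace ℝ (Fin 3), 0 < X 2 →
      ∑ i : Fin 3, (fderiv ℝ V X (EuclideanSpace.single i (1 : ℝ))) i = 0)
    (hperw : ∀ X : EuclideanSpace ℝ (Fin 3), 0 < X 2 → X 2 ≤ 2 →
      V (X + EuclideanSpace.single 0 (1 : ℝ)) = V X ∧ V (X + EuclideanSpace.single 1 (1 : ℝ)) = V X)
    (s t : ℝ) (hs : 0 < s) (hst : s ≤ t) (ht : t < 1) :
    ∫ q in Icc (0 : ℝ) 1 ×ˢ Icc (0 : ℝ) 1, (V !₂[q.1, q.2, t]) 2 =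
      ∫ q in Icc (0 : ℝ) 1 ×ˢ Icc (0 : ℝ) 1, (V !₂[q.1, q.2, s]) 2 := by
  set S : Set (EuclideanSpace ℝ (Fin 3)) := {Y | 0 < Y 2 ∧ Y 2 < 1} with hS
  have hopen : IsOpen {X : EuclideanSpace ℝ (Fin 3) | 0 < X 2} :=
    isOpen_lt continuous_const (PiLp.continuous_apply 2 _ 2)
  have hSo : IsOpen S := hopen.inter (isOpen_lt (PiLp.continuous_apply 2 _ 2) continuous_const)
  -- the capped field, globally periodic
  set Vc : EuclideanSpace ℝ (Fin 3) → EuclideanSpace ℝ (Fin 3) :=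
    fun Y => if 0 < Y 2 ∧ Y 2 ≤ 2 then V Y else 0 with hVc
  have hVcS : ∀ Y ∈ S, Vc Y = V Y := fun Y hY => by
    simp only [hVc, if_pos (show 0 < Y 2 ∧ Y 2 ≤ 2 from ⟨hY.1, by linarith [hY.2]⟩)]
  have hVcper : ∀ (j : Fin 3), (j = 0 ∨ j = 1) → ∀ Y : EuclideanSpace ℝ (Fin 3),
      Vc (Y + EuclideanSpace.single j (1 : ℝ)) = Vc Y := by
    intro j hj Y
    have hY2 : (Y + EuclideanSpace.single j (1 : ℝ)) 2 = Y 2 := by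
      rcases hj with rfl | rfl <;> simp
    by_cases h : 0 < Y 2 ∧ Y 2 ≤ 2
    · simp only [hVc, hY2, if_pos h]
      rcases hj with rfl | rfl
      · exact (hperw Y h.1 h.2).1
      · exact (hperw Y h.1 h.2).2
    · simp only [hVc, hY2, if_neg h]
  set φ : Fin 3 → EuclideanSpace ℝ (Fin 3) → ℝ := fun i Y => (Vc Y) i with hφ
  have hφS : ∀ i, ∀ Y ∈ S, φ i Y = (V Y) i := fun i Y hY => by simp only [hφ, hVcS Y hY]
  have hφ1 : ∀ i, ContDiffOn ℝ 1 (φ i) S := by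
    intro i
    have h1 : ContDiffOn ℝ 1 (fun Y => (V Y) i) S :=
      ((EuclideanSpace.proj i).contDiff.comp_contDiffOn (hV.mono fun Y hY => hY.1)).of_le
        (mod_cast le_top)
    exact h1.congr (hφS i)
  have key := lerayCapping_box_divergence φ s t hs hst ht hφ1
    (fun Y => congrArg (fun v : EuclideanSpace ℝ (Fin 3) => v 0) (hVcper 0 (Or.inl rfl) Y))
    (fun Y => congrArg (fun v : EuclideanSpace ℝ (Fin 3) => v 1) (hVcper 1 (Or.inr rfl) Y))
  -- the divergence vanishes on the box
  have hzero : ∀ x ∈ Icc (![0, 0, s] : Fin 3 → ℝ) ![1, 1, t],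
      ∑ i : Fin 3, fderiv ℝ (φ i) (WithLp.toLp 2 x) (EuclideanSpace.single i (1 : ℝ)) = 0 := by
    intro x hx
    set Y : EuclideanSpace ℝ (Fin 3) := WithLp.toLp 2 x with hY
    have hYS : Y ∈ S := by
      rw [mem_Icc, Pi.le_def, Pi.le_def] at hx
      have h0 := hx.1 2; have h1 := hx.2 2
      simp at h0 h1
      refine ⟨?_, ?_⟩ <;> simp [hY] <;> linarith
    have hVd : DifferentiableAt ℝ V Y :=
      (hV.differentiableOn (by simp)).differentiableAt (hopen.mem_nhds hYS.1)
    have hfd : ∀ i, fderiv ℝ (φ i) Y = (EuclideanSpace.proj i).comp (fderiv ℝ V Y) := by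
      intro i
      have hev : φ i =ᶠ[𝓝 Y] fun Z => (V Z) i :=
        Filter.eventuallyEq_of_mem (hSo.mem_nhds hYS) (hφS i)
      rw [hev.fderiv_eq]
      exact ((EuclideanSpace.proj i).hasFDerivAt.comp Y hVd.hasFDerivAt).fderiv
    simp only [hfd, ContinuousLinearMap.coe_comp, comp_apply]
    exact hdiv Y hYS.1
  rw [setIntegral_congr_fun measurableSet_Icc hzero] at key
  simp only [MeasureTheory.integral_zero] at key
  -- the horizontal faces
  have hface : ∀ (r : ℝ), 0 < r → r < 1 → ∀ q : ℝ × ℝ, φ 2 !₂[q.1, q.2, r] = (V !₂[q.1, q.2, r]) 2 := by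
    intro r hr hr1 q
    exact hφS 2 _ ⟨by simpa using hr, by simpa using hr1⟩
  simp_rw [hface t (hs.trans_le hst) ht, hface s hs (hst.trans_lt ht)] at key
  linarith

/-- **Zero mass flux on every slice.** If moreover `V` is dilation invariant and the mass flux
through the unit square at height `1` vanishes, then `∫_{[0,1]²} V₂(q, t) dq = 0` for all
`0 < t < 1`. [folklore] -/
theorem lerayCapping_massflux_zero
    (V : EuclideanSpace ℝ (Fin 3) → EuclideanSpace ℝ (Fin 3)) (Q : EuclideanSpace ℝ (Fin 3) → ℝ)
    (hV : ContDiffOn ℝ ((⊤ : ℕ∞) : WithTop ℕ∞) V {X : EuclideanSpace ℝ (Fin 3) | 0 < X 2})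
    (hdiv : ∀ X : EuclideanSpace ℝ (Fin 3), 0 < X 2 →
      ∑ i : Fin 3, (fderiv ℝ V X (EuclideanSpace.single i (1 : ℝ))) i = 0)
    (hdil : ∀ X : EuclideanSpace ℝ (Fin 3), 0 < X 2 → V ((2 : ℝ) • X) = V X ∧ Q ((2 : ℝ) • X) = Q X)
    (hper : ∀ X : EuclideanSpace ℝ (Fin 3), 1 ≤ X 2 → X 2 ≤ 2 →
      V (X + EuclideanSpace.single 0 (1 : ℝ)) = V X ∧ V (X + EuclideanSpace.single 1 (1 : ℝ)) = V X ∧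
      Q (X + EuclideanSpace.single 0 (1 : ℝ)) = Q X ∧ Q (X + EuclideanSpace.single 1 (1 : ℝ)) = Q X)
    (hmass : ∫ q in Icc (0 : ℝ) 1 ×ˢ Icc (0 : ℝ) 1, (V !₂[q.1, q.2, (1 : ℝ)]) 2 = 0)
    (t : ℝ) (ht : 0 < t) (ht1 : t < 1) :
    ∫ q in Icc (0 : ℝ) 1 ×ˢ Icc (0 : ℝ) 1, (V !₂[q.1, q.2, t]) 2 = 0 := by
  have hperw : ∀ X : EuclideanSpace ℝ (Fin 3), 0 < X 2 → X 2 ≤ 2 →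
      V (X + EuclideanSpace.single 0 (1 : ℝ)) = V X ∧ V (X + EuclideanSpace.single 1 (1 : ℝ)) = V X :=
    fun X h1 h2 => let h := lerayCapping_periodic_near_wall V Q hdil hper X h1 h2; ⟨h.1, h.2.1⟩
  -- the flux at height `1/2` equals the flux at height `1`
  have hhalf : ∫ q in Icc (0 : ℝ) 1 ×ˢ Icc (0 : ℝ) 1, (V !₂[q.1, q.2, (2 : ℝ)⁻¹]) 2 = 0 := by
    have h := lerayCapping_slice_dyadic (fun X => (V X) 2)
      ((PiLp.continuous_apply 2 (fun _ : Fin 3 => ℝ) 2).comp_continuousOn hV.continuousOn)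
      (fun X hX => by simp only [(hdil X hX).1]) (fun X h1 h2 => ?_) 1
    · rw [pow_one] at h
      rw [h]
      exact hmass
    · simp only [(hper X h1 h2).1, (hper X h1 h2).2.1, and_self]
  rcases le_or_gt t 2⁻¹ with h | h
  · rw [← lerayCapping_massflux_indep V hV hdiv hperw t 2⁻¹ ht h (by norm_num)]
    exact hhalf
  · rw [lerayCapping_massflux_indep V hV hdiv hperw 2⁻¹ t (by norm_num) h.le ht1]
    exact hhalf

/-- **Zero mass flux, iterated form**: `∫₀¹ ∫₀¹ V₂(u, s, t) du ds = 0` for `0 < t < 1` (Fubini,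
the trace of `V` at height `t` being continuous). [folklore] -/
theorem lerayCapping_massflux_zero_iter
    (V : EuclideanSpace ℝ (Fin 3) → EuclideanSpace ℝ (Fin 3))
    (hVc : ContinuousOn V {X : EuclideanSpace ℝ (Fin 3) | 0 < X 2}) (t : ℝ) (ht : 0 < t)
    (hzero : ∫ q in Icc (0 : ℝ) 1 ×ˢ Icc (0 : ℝ) 1, (V !₂[q.1, q.2, t]) 2 = 0) :
    ∫ s in (0 : ℝ)..1, ∫ u in (0 : ℝ)..1, (V !₂[u, s, t]) 2 = 0 := by
  set F : ℝ × ℝ → ℝ := fun q => (V !₂[q.1, q.2, t]) 2 with hF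
  have hemb : Continuous fun q : ℝ × ℝ => (!₂[q.1, q.2, t] : EuclideanSpace ℝ (Fin 3)) := by
    refine (PiLp.continuous_toLp 2 _).comp (continuous_pi fun i => ?_)
    fin_cases i
    · simpa using continuous_fst
    · simpa using continuous_snd
    · simpa using continuous_const
  have hFc : Continuous F := by
    refine (PiLp.continuous_apply 2 _ 2).comp (hVc.comp_continuous hemb fun q => ?_)
    simpa using ht
  have hFs : Continuous fun z : ℝ × ℝ => F z.swap := hFc.comp continuous_swap
  -- swap the variables in the cell integral
  have hswap : ∫ z in Icc (0 : ℝ) 1 ×ˢ Icc (0 : ℝ) 1, F z.swap = 0 := by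
    rw [Measure.volume_eq_prod, setIntegral_prod_swap, ← Measure.volume_eq_prod]
    exact hzero
  rw [Measure.volume_eq_prod, setIntegral_prod _
    (hFs.continuousOn.integrableOn_compact (isCompact_Icc.prod isCompact_Icc))] at hswap
  rw [intervalIntegral.integral_of_le zero_le_one, ← integral_Icc_eq_integral_Ioc]
  refine Eq.trans (setIntegral_congr_fun measurableSet_Icc fun s _ => ?_) hswap
  rw [intervalIntegral.integral_of_le zero_le_one, ← integral_Icc_eq_integral_Ioc]
  rfl

/-- **Smoothness from a two-piece open cover**: a function smooth on an open set `O` and vanishing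
on an open set `N` with `O ∪ N = ℝ³` is smooth. [folklore] -/
theorem lerayCapping_contDiff_of_zero_cover {F : Type*} [NormedAddCommGroup F] [NormedSpace ℝ F]
    (f : EuclideanSpace ℝ (Fin 3) → F) (O N : Set (EuclideanSpace ℝ (Fin 3))) (hO : IsOpen O)
    (hN : IsOpen N) (hcov : ∀ Y, Y ∈ O ∨ Y ∈ N) (hf : ContDiffOn ℝ ((⊤ : ℕ∞) : WithTop ℕ∞) f O)
    (hz : ∀ Y ∈ N, f Y = 0) : ContDiff ℝ ((⊤ : ℕ∞) : WithTop ℕ∞) f := by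
  refine contDiff_iff_contDiffAt.2 fun Y => ?_
  rcases hcov Y with hY | hY
  · exact hf.contDiffAt (hO.mem_nhds hY)
  · have hev : f =ᶠ[𝓝 Y] fun _ => 0 := Filter.eventuallyEq_of_mem (hN.mem_nhds hY) hz
    exact (contDiffAt_const (c := (0 : F))).congr_of_eventuallyEq hev

/-- **The lid corrector.** For a half-space hierarchy `V` (smooth, divergence free, dilation
invariant, band periodic, zero mass flux) and a smooth vertical cut-off `θ` with `θ' = 0` off
`(5/64, 7/64)`, there is a smooth horizontal field `c = (c₀, c₁, 0)` on `ℝ³`, `1`-periodic in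
`Y₀, Y₁`, vanishing unless `5/64 < Y₂ < 7/64` or `57/64 < Y₂ < 59/64`, with
`div c (Y) = −(θ'(Y₂) V₂(Y) + θ'(1 − Y₂) V₂(A Y))`, `A Y = Y + (1 − 2Y₂)e₂`, on `0 < Y₂ < 1`.
[folklore] -/
theorem lerayCapping_lid_corrector
    (V : EuclideanSpace ℝ (Fin 3) → EuclideanSpace ℝ (Fin 3)) (Q : EuclideanSpace ℝ (Fin 3) → ℝ)
    (θ : ℝ → ℝ)
    (hV : ContDiffOn ℝ ((⊤ : ℕ∞) : WithTop ℕ∞) V {X : EuclideanSpace ℝ (Fin 3) | 0 < X 2})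
    (hdiv : ∀ X : EuclideanSpace ℝ (Fin 3), 0 < X 2 →
      ∑ i : Fin 3, (fderiv ℝ V X (EuclideanSpace.single i (1 : ℝ))) i = 0)
    (hdil : ∀ X : EuclideanSpace ℝ (Fin 3), 0 < X 2 → V ((2 : ℝ) • X) = V X ∧ Q ((2 : ℝ) • X) = Q X)
    (hper : ∀ X : EuclideanSpace ℝ (Fin 3), 1 ≤ X 2 → X 2 ≤ 2 →
      V (X + EuclideanSpace.single 0 (1 : ℝ)) = V X ∧ V (X + EuclideanSpace.single 1 (1 : ℝ)) = V X ∧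
      Q (X + EuclideanSpace.single 0 (1 : ℝ)) = Q X ∧ Q (X + EuclideanSpace.single 1 (1 : ℝ)) = Q X)
    (hmass : ∫ q in Icc (0 : ℝ) 1 ×ˢ Icc (0 : ℝ) 1, (V !₂[q.1, q.2, (1 : ℝ)]) 2 = 0)
    (hθ : ContDiff ℝ ((⊤ : ℕ∞) : WithTop ℕ∞) θ)
    (hθ' : ∀ t : ℝ, (t ≤ 5 / 64 ∨ 7 / 64 ≤ t) → deriv θ t = 0) :
    ∃ c : EuclideanSpace ℝ (Fin 3) → EuclideanSpace ℝ (Fin 3),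
      ContDiff ℝ ((⊤ : ℕ∞) : WithTop ℕ∞) c ∧
      (∀ Y : EuclideanSpace ℝ (Fin 3), c (Y + EuclideanSpace.single 0 (1 : ℝ)) = c Y) ∧
      (∀ Y : EuclideanSpace ℝ (Fin 3), c (Y + EuclideanSpace.single 1 (1 : ℝ)) = c Y) ∧
      (∀ Y : EuclideanSpace ℝ (Fin 3), c Y 2 = 0) ∧
      (∀ Y : EuclideanSpace ℝ (Fin 3), 0 < Y 2 → Y 2 < 1 →
        ∑ i : Fin 3, (fderiv ℝ c Y (EuclideanSpace.single i (1 : ℝ))) i =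
          -(deriv θ (Y 2) * (V Y) 2 +
            deriv θ (1 - Y 2) * (V (Y + (1 - 2 * Y 2) • EuclideanSpace.single 2 (1 : ℝ))) 2)) ∧
      (∀ Y : EuclideanSpace ℝ (Fin 3), (Y 2 ≤ 5 / 64 ∨ (7 / 64 ≤ Y 2 ∧ Y 2 ≤ 57 / 64) ∨ 59 / 64 ≤ Y 2) →
        c Y = 0) := by
  set e0 : EuclideanSpace ℝ (Fin 3) := EuclideanSpace.single 0 (1 : ℝ) with he0
  set e1 : EuclideanSpace ℝ (Fin 3) := EuclideanSpace.single 1 (1 : ℝ) with he1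
  set e2 : EuclideanSpace ℝ (Fin 3) := EuclideanSpace.single 2 (1 : ℝ) with he2
  have hopen : IsOpen {X : EuclideanSpace ℝ (Fin 3) | 0 < X 2} :=
    isOpen_lt continuous_const (PiLp.continuous_apply 2 _ 2)
  have hc2 : ContDiff ℝ ∞ fun Y : EuclideanSpace ℝ (Fin 3) => Y 2 := contDiff_piLp_apply (p := 2)
  have hperw : ∀ X : EuclideanSpace ℝ (Fin 3), 0 < X 2 → X 2 ≤ 2 →
      V (X + e0) = V X ∧ V (X + e1) = V X := fun X h1 h2 =>
    let h := lerayCapping_periodic_near_wall V Q hdil hper X h1 h2; ⟨h.1, h.2.1⟩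
  -- the extension by zero and the affine reflection
  set Vp : EuclideanSpace ℝ (Fin 3) → EuclideanSpace ℝ (Fin 3) := fun Y => if 0 < Y 2 then V Y else 0
    with hVp
  have hVp_pos : ∀ Y : EuclideanSpace ℝ (Fin 3), 0 < Y 2 → Vp Y = V Y := fun Y hY => by
    simp only [hVp, if_pos hY]
  have hVp_np : ∀ Y : EuclideanSpace ℝ (Fin 3), ¬ 0 < Y 2 → Vp Y = 0 := fun Y hY => by
    simp only [hVp, if_neg hY]
  have hVpS : ContDiffOn ℝ ∞ Vp {X : EuclideanSpace ℝ (Fin 3) | 0 < X 2} :=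
    hV.congr fun Y hY => hVp_pos Y hY
  have hVp_per : ∀ (j : Fin 3), (j = 0 ∨ j = 1) → ∀ Y : EuclideanSpace ℝ (Fin 3), Y 2 ≤ 2 →
      Vp (Y + EuclideanSpace.single j (1 : ℝ)) = Vp Y := by
    intro j hj Y hY2
    have hYj : (Y + EuclideanSpace.single j (1 : ℝ)) 2 = Y 2 := by
      rcases hj with rfl | rfl <;> simp
    by_cases h : 0 < Y 2
    · rw [hVp_pos _ (by rw [hYj]; exact h), hVp_pos _ h]
      rcases hj with rfl | rfl
      · exact (hperw Y h hY2).1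
      · exact (hperw Y h hY2).2
    · rw [hVp_np _ (by rw [hYj]; exact h), hVp_np _ h]
  set A : EuclideanSpace ℝ (Fin 3) → EuclideanSpace ℝ (Fin 3) := fun Y => Y + (1 - 2 * Y 2) • e2 with hA
  have hA2 : ∀ Y, (A Y) 2 = 1 - Y 2 := fun Y => by simp [hA, he2]; ring
  have hAs : ContDiff ℝ ∞ A := contDiff_id.add ((contDiff_const.sub (contDiff_const.mul hc2)).smul contDiff_const)
  have hAj : ∀ (j : Fin 3), (j = 0 ∨ j = 1) → ∀ Y : EuclideanSpace ℝ (Fin 3),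
      A (Y + EuclideanSpace.single j (1 : ℝ)) = A Y + EuclideanSpace.single j (1 : ℝ) := by
    intro j hj Y
    have hYj : (Y + EuclideanSpace.single j (1 : ℝ)) 2 = Y 2 := by
      rcases hj with rfl | rfl <;> simp
    simp only [hA, hYj]
    abel
  have hApt : ∀ u s r : ℝ, A !₂[u, s, r] = !₂[u, s, 1 - r] := by
    intro u s r
    ext i
    fin_cases i <;> simp [hA, he2]
    ring
  -- the source term
  set g : EuclideanSpace ℝ (Fin 3) → ℝ := fun Y =>
    -(deriv θ (Y 2) * (Vp Y) 2 + deriv θ (1 - Y 2) * (Vp (A Y)) 2) with hg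
  have hdθ : ContDiff ℝ ∞ (deriv θ) := (contDiff_infty_iff_deriv.1 hθ).2
  -- smoothness of the two pieces
  have hVp2 : ContDiffOn ℝ ∞ (fun Y => (Vp Y) 2) {X : EuclideanSpace ℝ (Fin 3) | 0 < X 2} :=
    (EuclideanSpace.proj (𝕜 := ℝ) (2 : Fin 3)).contDiff.comp_contDiffOn hVpS
  have hVpA2 : ContDiffOn ℝ ∞ (fun Y => (Vp (A Y)) 2) {Y : EuclideanSpace ℝ (Fin 3) | Y 2 < 1} := by
    refine (EuclideanSpace.proj (𝕜 := ℝ) (2 : Fin 3)).contDiff.comp_contDiffOn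
      (hVpS.comp hAs.contDiffOn fun Y hY => ?_)
    show 0 < (A Y) 2
    rw [hA2]; simp only [mem_setOf_eq] at hY; linarith
  have hg1 : ContDiff ℝ ∞ fun Y : EuclideanSpace ℝ (Fin 3) => deriv θ (Y 2) * (Vp Y) 2 := by
    refine lerayCapping_contDiff_of_zero_cover _ {Y | 0 < Y 2} {Y | Y 2 < 5 / 64} hopen
      (isOpen_lt (PiLp.continuous_apply 2 (fun _ : Fin 3 => ℝ) 2) continuous_const)
      (fun Y => ?_) ?_ ?_
    · exact (lt_or_ge 0 (Y 2)).imp id fun h => show Y 2 < 5 / 64 by linarith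
    · exact ((hdθ.comp hc2).contDiffOn).mul hVp2
    · intro Y hY
      rw [hθ' _ (Or.inl (le_of_lt hY)), zero_mul]
  have hg2 : ContDiff ℝ ∞ fun Y : EuclideanSpace ℝ (Fin 3) => deriv θ (1 - Y 2) * (Vp (A Y)) 2 := by
    refine lerayCapping_contDiff_of_zero_cover _ {Y | Y 2 < 1} {Y | 59 / 64 < Y 2}
      (isOpen_lt (PiLp.continuous_apply 2 (fun _ : Fin 3 => ℝ) 2) continuous_const)
      (isOpen_lt continuous_const (PiLp.continuous_apply 2 (fun _ : Fin 3 => ℝ) 2))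
      (fun Y => ?_) ?_ ?_
    · exact (lt_or_ge (Y 2) 1).imp id fun h => show 59 / 64 < Y 2 by linarith
    · exact ((hdθ.comp (contDiff_const.sub hc2)).contDiffOn).mul hVpA2
    · intro Y hY
      have : 59 / 64 < Y 2 := hY
      rw [hθ' _ (Or.inl (by linarith)), zero_mul]
  have hgs : ContDiff ℝ ∞ g := (hg1.add hg2).neg
  -- periodicity of the source
  have hgper : ∀ (j : Fin 3), (j = 0 ∨ j = 1) → ∀ Y : EuclideanSpace ℝ (Fin 3),
      g (Y + EuclideanSpace.single j (1 : ℝ)) = g Y := by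
    intro j hj Y
    have hYj : (Y + EuclideanSpace.single j (1 : ℝ)) 2 = Y 2 := by
      rcases hj with rfl | rfl <;> simp
    have h1 : deriv θ (Y 2) * (Vp (Y + EuclideanSpace.single j (1 : ℝ))) 2 =
        deriv θ (Y 2) * (Vp Y) 2 := by
      by_cases hY : Y 2 ≤ 2
      · rw [hVp_per j hj Y hY]
      · rw [hθ' _ (Or.inr (by linarith [not_le.1 hY])), zero_mul, zero_mul]
    have h2 : deriv θ (1 - Y 2) * (Vp (A (Y + EuclideanSpace.single j (1 : ℝ)))) 2 =
        deriv θ (1 - Y 2) * (Vp (A Y)) 2 := by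
      rw [hAj j hj Y]
      by_cases hY : (A Y) 2 ≤ 2
      · rw [hVp_per j hj (A Y) hY]
      · rw [hA2] at hY
        rw [hθ' _ (Or.inr (by linarith [not_le.1 hY])), zero_mul, zero_mul]
    simp only [hg, hYj, h1, h2]
  -- slice means of the source vanish
  have hVcont : ContinuousOn V {X : EuclideanSpace ℝ (Fin 3) | 0 < X 2} := hV.continuousOn
  have hM : ∀ r : ℝ, 0 < r → r < 1 → ∫ s in (0 : ℝ)..1, ∫ u in (0 : ℝ)..1, (Vp !₂[u, s, r]) 2 = 0 := by
    intro r hr hr1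
    have h := lerayCapping_massflux_zero_iter V hVcont r hr
      (lerayCapping_massflux_zero V Q hV hdiv hdil hper hmass r hr hr1)
    refine Eq.trans (intervalIntegral.integral_congr fun s _ =>
      intervalIntegral.integral_congr fun u _ => ?_) h
    simp only
    rw [hVp_pos _ (by simpa using hr)]
  have hgpt : ∀ u s r : ℝ, g !₂[u, s, r] =
      -(deriv θ r * (Vp !₂[u, s, r]) 2 + deriv θ (1 - r) * (Vp !₂[u, s, 1 - r]) 2) := by
    intro u s r
    have hr2 : (!₂[u, s, r] : EuclideanSpace ℝ (Fin 3)) 2 = r := by simp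
    show -(deriv θ ((!₂[u, s, r] : EuclideanSpace ℝ (Fin 3)) 2) * (Vp !₂[u, s, r]) 2 +
      deriv θ (1 - (!₂[u, s, r] : EuclideanSpace ℝ (Fin 3)) 2) * (Vp (A !₂[u, s, r])) 2) = _
    rw [hr2, hApt]
  have hmean : ∀ r : ℝ, ∫ s in (0 : ℝ)..1, ∫ u in (0 : ℝ)..1, g !₂[u, s, r] = 0 := by
    intro r
    by_cases h1 : deriv θ r = 0
    · by_cases h2 : deriv θ (1 - r) = 0
      · have : ∀ u s : ℝ, g !₂[u, s, r] = 0 := fun u s => by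
          rw [hgpt, h1, h2]; ring
        simp_rw [this, intervalIntegral.integral_zero]
      · -- the mirrored band
        have hr' : 5 / 64 < 1 - r ∧ 1 - r < 7 / 64 := by
          by_contra hcon
          exact h2 (hθ' _ (by rw [not_and_or, not_lt, not_lt] at hcon; tauto))
        have : ∀ u s : ℝ, g !₂[u, s, r] = -deriv θ (1 - r) * (Vp !₂[u, s, 1 - r]) 2 := fun u s => by
          rw [hgpt, h1]; ring
        simp_rw [this, intervalIntegral.integral_const_mul, hM (1 - r) (by linarith) (by linarith),
          mul_zero]
    · have hr' : 5 / 64 < r ∧ r < 7 / 64 := by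
        by_contra hcon
        exact h1 (hθ' _ (by rw [not_and_or, not_lt, not_lt] at hcon; tauto))
      have h2 : deriv θ (1 - r) = 0 := hθ' _ (Or.inr (by linarith))
      have : ∀ u s : ℝ, g !₂[u, s, r] = -deriv θ r * (Vp !₂[u, s, r]) 2 := fun u s => by
        rw [hgpt, h2]; ring
      simp_rw [this, intervalIntegral.integral_const_mul, hM r (by linarith) (by linarith), mul_zero]
  -- the corrector
  obtain ⟨c, hcs, hc0, hc1, hc2', hcdiv, hcsupp⟩ :=
    lerayCapping_corrector g hgs (hgper 0 (Or.inl rfl)) (hgper 1 (Or.inr rfl))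
  refine ⟨c, hcs, hc0, hc1, hc2', fun Y hY0 hY1 => ?_, fun Y hY => ?_⟩
  · rw [hcdiv Y, hmean (Y 2), sub_zero]
    simp only [hg]
    rw [hVp_pos Y hY0, hVp_pos (A Y) (by rw [hA2]; linarith)]
  · refine hcsupp (Y 2) (fun a b => ?_) Y rfl
    have hd1 : deriv θ (Y 2) = 0 := hθ' _ (by rcases hY with h | h | h <;> [left; right; right] <;> linarith)
    have hd2 : deriv θ (1 - Y 2) = 0 :=
      hθ' _ (by rcases hY with h | h | h <;> [right; right; left] <;> linarith)
    rw [hgpt, hd1, hd2]; ring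

/-- Registered tools stub of `stub_lerayCapping` (line Sketch of crux `DyadicRealisation`): the
conjunction of the lemmas of this file. [folklore] -/
theorem stub_lerayCappingTools5 :
    (∀ (V : EuclideanSpace ℝ (Fin 3) → EuclideanSpace ℝ (Fin 3)), ContDiffOn ℝ ((⊤ : ℕ∞) : WithTop ℕ∞) V {X : EuclideanSpace ℝ (Fin 3) | 0 < X 2} →
      (∀ X : EuclideanSpace ℝ (Fin 3), 0 < X 2 → ∑ i : Fin 3, (fderiv ℝ V X (EuclideanSpace.single i (1 : ℝ))) i = 0) →
      (∀ X : EuclideanSpace ℝ (Fin 3), 0 < X 2 → X 2 ≤ 2 →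
        V (X + EuclideanSpace.single 0 (1 : ℝ)) = V X ∧ V (X + EuclideanSpace.single 1 (1 : ℝ)) = V X) →
      ∀ s t : ℝ, 0 < s → s ≤ t → t < 1 →
        ∫ q in Set.Icc (0 : ℝ) 1 ×ˢ Set.Icc (0 : ℝ) 1, (V !₂[q.1, q.2, t]) 2 =
          ∫ q in Set.Icc (0 : ℝ) 1 ×ˢ Set.Icc (0 : ℝ) 1, (V !₂[q.1, q.2, s]) 2) ∧
    (∀ (V : EuclideanSpace ℝ (Fin 3) → EuclideanSpace ℝ (Fin 3)) (Q : EuclideanSpace ℝ (Fin 3) → ℝ), ContDiffOn ℝ ((⊤ : ℕ∞) : WithTop ℕ∞) V {X : EuclideanSpace ℝ (Fin 3) | 0 < X 2} →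
      (∀ X : EuclideanSpace ℝ (Fin 3), 0 < X 2 → ∑ i : Fin 3, (fderiv ℝ V X (EuclideanSpace.single i (1 : ℝ))) i = 0) →
      (∀ X : EuclideanSpace ℝ (Fin 3), 0 < X 2 → V ((2 : ℝ) • X) = V X ∧ Q ((2 : ℝ) • X) = Q X) →
      (∀ X : EuclideanSpace ℝ (Fin 3), 1 ≤ X 2 → X 2 ≤ 2 →
        V (X + EuclideanSpace.single 0 (1 : ℝ)) = V X ∧ V (X + EuclideanSpace.single 1 (1 : ℝ)) = V X ∧
        Q (X + EuclideanSpace.single 0 (1 : ℝ)) = Q X ∧ Q (X + EuclideanSpace.single 1 (1 : ℝ)) = Q X) →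
      (∫ q in Set.Icc (0 : ℝ) 1 ×ˢ Set.Icc (0 : ℝ) 1, (V !₂[q.1, q.2, (1 : ℝ)]) 2 = 0) →
      ∀ t : ℝ, 0 < t → t < 1 → ∫ q in Set.Icc (0 : ℝ) 1 ×ˢ Set.Icc (0 : ℝ) 1, (V !₂[q.1, q.2, t]) 2 = 0) ∧
    (∀ (V : EuclideanSpace ℝ (Fin 3) → EuclideanSpace ℝ (Fin 3)), ContinuousOn V {X : EuclideanSpace ℝ (Fin 3) | 0 < X 2} → ∀ t : ℝ, 0 < t →
      (∫ q in Set.Icc (0 : ℝ) 1 ×ˢ Set.Icc (0 : ℝ) 1, (V !₂[q.1, q.2, t]) 2 = 0) →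
      ∫ s in (0 : ℝ)..1, ∫ u in (0 : ℝ)..1, (V !₂[u, s, t]) 2 = 0) ∧
    (∀ {F : Type*} [NormedAddCommGroup F] [NormedSpace ℝ F] (f : EuclideanSpace ℝ (Fin 3) → F) (O N : Set (EuclideanSpace ℝ (Fin 3))),
      IsOpen O → IsOpen N → (∀ Y, Y ∈ O ∨ Y ∈ N) → ContDiffOn ℝ ((⊤ : ℕ∞) : WithTop ℕ∞) f O →
      (∀ Y ∈ N, f Y = 0) → ContDiff ℝ ((⊤ : ℕ∞) : WithTop ℕ∞) f) ∧
    (∀ (V : EuclideanSpace ℝ (Fin 3) → EuclideanSpace ℝ (Fin 3)) (Q : EuclideanSpace ℝ (Fin 3) → ℝ) (θ : ℝ → ℝ), ContDiffOn ℝ ((⊤ : ℕ∞) : WithTop ℕ∞) V {X : EuclideanSpace ℝ (Fin 3) | 0 < X 2} →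
      (∀ X : EuclideanSpace ℝ (Fin 3), 0 < X 2 → ∑ i : Fin 3, (fderiv ℝ V X (EuclideanSpace.single i (1 : ℝ))) i = 0) →
      (∀ X : EuclideanSpace ℝ (Fin 3), 0 < X 2 → V ((2 : ℝ) • X) = V X ∧ Q ((2 : ℝ) • X) = Q X) →
      (∀ X : EuclideanSpace ℝ (Fin 3), 1 ≤ X 2 → X 2 ≤ 2 →
        V (X + EuclideanSpace.single 0 (1 : ℝ)) = V X ∧ V (X + EuclideanSpace.single 1 (1 : ℝ)) = V X ∧
        Q (X + EuclideanSpace.single 0 (1 : ℝ)) = Q X ∧ Q (X + EuclideanSpace.single 1 (1 : ℝ)) = Q X) →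
      (∫ q in Set.Icc (0 : ℝ) 1 ×ˢ Set.Icc (0 : ℝ) 1, (V !₂[q.1, q.2, (1 : ℝ)]) 2 = 0) →
      ContDiff ℝ ((⊤ : ℕ∞) : WithTop ℕ∞) θ → (∀ t : ℝ, (t ≤ 5 / 64 ∨ 7 / 64 ≤ t) → deriv θ t = 0) →
      ∃ c : EuclideanSpace ℝ (Fin 3) → EuclideanSpace ℝ (Fin 3),
        ContDiff ℝ ((⊤ : ℕ∞) : WithTop ℕ∞) c ∧
        (∀ Y : EuclideanSpace ℝ (Fin 3), c (Y + EuclideanSpace.single 0 (1 : ℝ)) = c Y) ∧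
        (∀ Y : EuclideanSpace ℝ (Fin 3), c (Y + EuclideanSpace.single 1 (1 : ℝ)) = c Y) ∧
        (∀ Y : EuclideanSpace ℝ (Fin 3), c Y 2 = 0) ∧
        (∀ Y : EuclideanSpace ℝ (Fin 3), 0 < Y 2 → Y 2 < 1 →
          ∑ i : Fin 3, (fderiv ℝ c Y (EuclideanSpace.single i (1 : ℝ))) i =
            -(deriv θ (Y 2) * (V Y) 2 +
              deriv θ (1 - Y 2) * (V (Y + (1 - 2 * Y 2) • EuclideanSpace.single 2 (1 : ℝ))) 2)) ∧
        (∀ Y : EuclideanSpace ℝ (Fin 3), (Y 2 ≤ 5 / 64 ∨ (7 / 64 ≤ Y 2 ∧ Y 2 ≤ 57 / 64) ∨ 59 / 64 ≤ Y 2) → c Y = 0)) :=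
  ⟨lerayCapping_massflux_indep, lerayCapping_massflux_zero, lerayCapping_massflux_zero_iter,
    fun f O N hO hN hcov hf hz => lerayCapping_contDiff_of_zero_cover f O N hO hN hcov hf hz,
    lerayCapping_lid_corrector⟩

end Summit.AnomalousDissipation.AnomalousDissipation.Theorems
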